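import Summits.Parity.GeneralizedHardyLittlewood.Theorems.PrimeLevelFamEdgeMomentsBeyondDiagonalFirstOrderDiagBridge
import Summits.Parity.GeneralizedHardyLittlewood.Theorems.PrimeLevelFamEdgeMomentsBeyondDiagonalFirstOrderDiagAsymp
import HarnessLib

/-!
# The diagonal main term of the order-`j` mollified first moment at `M = q̂^{Δ'}`:
# `Σ_{m ≤ M} x_m m^{−1/2} 𝒱_j(log(q̂/m)) = ζ(2) ℓ^{j−1}(P′(1)/Δ' + j P(1)) + O(ℓ^{j−2})`, `ℓ = log q̂`
# (helper for crux K_A `PrimeLevelFamEdge.MomentsBeyondDiagonal`, stmt-Parity-20007, stub `stub_first : SubFirst` ∀`Q`)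

Combination of the bridge identity (`mollifierDiag_eq_sum_choose`), the order-`i` diagonal asymptotic (`diagSum_mul_sq_log_sub_le`,
with `θ = (Δ'−1)/Δ'`, `Λ = log M = Δ'ℓ`, `θΛ = log M − log q̂`) and `γ_0 = 1`: for admissible `P`, `Δ' > 0` and `j` there is `C` with
`|ℓ² Σ_{m ≤ q̂^{Δ'}} x_m m^{−1/2} 𝒱_j(log(q̂/m)) − ζ(2) ℓ^{j+1}(P′(1)/Δ' + jP(1))| ≤ C ℓ^j` whenever `ℓ = log q̂ ≥ 1` and `q̂^{Δ'} ≥ 3`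
(`diagOrder_mul_sq_log_sub_le`). This is KMV's first-moment main term (30) at `Q = Y^j` after the `ℓ^{−j}` normalisation:
`ℓ^{−j}·ζ(2)ℓ^{j−1}(P′(1)/Δ' + jP(1))` summed against `Q_j` gives `ζ(2)/(Δ'ℓ)·(Q(1)P′(1) + Δ'Q′(1)P(1))`.
Proof only; nothing about Landau–Siegel zeros; K_A NOT proved.
-/

noncomputable section

open scoped Real
open Set MeasureTheory Finset Polynomial
open Literature.NumberTheory.LFunctions Literature.NumberTheory.LFunctions.KMV2000

namespace Summit.Parity.GeneralizedHardyLittlewood.Theorems.MomentsBeyondDiagonal.FirstOrderAFE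

set_option maxHeartbeats 400000 in
/-- **Diagonal main term at order `j`** (KMV §4.1 (19)–(20) at order `j`, `M = q̂^{Δ'}`): for admissible `P`, `Δ' > 0`, `j`,
there is `C` such that for all `q̂` with `log q̂ ≥ 1` and `q̂^{Δ'} ≥ 3`,
`|ℓ² Σ_{m ≤ q̂^{Δ'}} x_m m^{−1/2} 𝒱_j(log(q̂/m)) − (π²/6) ℓ^{j+1}(P′(1)/Δ' + jP(1))| ≤ C ℓ^j`, `ℓ = log q̂`.
[cite: KowalskiMichelVanderKam2000, §4.1 (19)–(20), §6 (30)] -/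
theorem diagOrder_mul_sq_log_sub_le {P : ℝ[X]} (hP : Admissible P) {Δ' : ℝ} (hΔ : 0 < Δ') (j : ℕ) :
    ∃ C : ℝ, ∀ qh : ℝ, 0 < qh → 1 ≤ Real.log qh → 3 ≤ qh ^ Δ' →
      |Real.log qh ^ 2 * ∑ m ∈ Finset.Icc 1 ⌊qh ^ Δ'⌋₊, mollifierCoeff P (qh ^ Δ') m * (m : ℝ) ^ (-(1 / 2 : ℝ)) *
            (∫ x in Ioi (0 : ℝ), Real.exp (-x) * (Real.log (qh / m) + Real.log x) ^ j) -
          π ^ 2 / 6 * Real.log qh ^ (j + 1) * ((derivative P).eval 1 / Δ' + (j : ℝ) * P.eval 1)| ≤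
        C * Real.log qh ^ j := by
  classical
  set θ : ℝ := (Δ' - 1) / Δ' with hθ
  have h1θ : 1 - θ = Δ'⁻¹ := by rw [hθ]; field_simp; ring
  -- constants `K i` of the order-`i` asymptotics
  have hK : ∀ i : ℕ, ∃ K : ℝ, 0 ≤ K ∧ ∀ M : ℝ, 3 ≤ M →
      |Real.log M ^ 2 * ∑ m ∈ Finset.Icc 1 ⌊M⌋₊, (ArithmeticFunction.moebius m : ℝ) * ((psi m)⁻¹ * (m : ℝ)⁻¹) *
            P.eval (Real.log (M / m) / Real.log M) * (Real.log (M / m) - θ * Real.log M) ^ i -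
          π ^ 2 / 6 * Real.log M ^ (i + 1) *
            ((derivative P).eval 1 * (1 - θ) ^ i + (i : ℝ) * P.eval 1 * (1 - θ) ^ (i - 1))| ≤ K * Real.log M ^ i := by
    intro i
    obtain ⟨K, hK⟩ := diagSum_mul_sq_log_sub_le hP θ i
    refine ⟨max K 0, le_max_right _ _, fun M hM ↦ (hK M hM).trans ?_⟩
    exact mul_le_mul_of_nonneg_right (le_max_left _ _) (pow_nonneg (Real.log_nonneg (by linarith)) _)
  choose K hK0 hK using hK
  set γ : ℕ → ℝ := fun l ↦ ∫ x in Ioi (0 : ℝ), Real.exp (-x) * (Real.log x) ^ l with hγ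
  -- the main coefficients `c i` and their sizes
  set c : ℕ → ℝ := fun i ↦ (derivative P).eval 1 * (1 - θ) ^ i + (i : ℝ) * P.eval 1 * (1 - θ) ^ (i - 1) with hc
  set E : ℕ → ℝ := fun i ↦ ((j.choose i : ℕ) : ℝ) * |γ (j - i)| *
    (K i * Δ' ^ i / Δ' ^ 2 + π ^ 2 / 6 * Δ' ^ (i + 1) / Δ' ^ 2 * |c i|) with hE
  refine ⟨∑ i ∈ range (j + 1), E i, fun qh hqh hℓ hM3 ↦ ?_⟩
  set ℓ : ℝ := Real.log qh with hℓdef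
  have hℓ1 : 1 ≤ ℓ := hℓ
  have hℓ0 : 0 < ℓ := by linarith
  set M : ℝ := qh ^ Δ' with hMdef
  have hM0 : 0 < M := Real.rpow_pos_of_pos hqh _
  have hΛ : Real.log M = Δ' * ℓ := by rw [hMdef, Real.log_rpow hqh]
  have hΛ0 : 0 < Real.log M := by rw [hΛ]; positivity
  have hshift : Real.log M - Real.log qh = θ * Real.log M := by
    rw [hΛ, hθ, ← hℓdef]; field_simp; try ring
  -- Step 1: bridge and shift
  rw [mollifierDiag_eq_sum_choose P hM0 hqh j, hshift, Finset.mul_sum]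
  -- Step 2: the target main term is the `i = j` term's main part; write everything as one sum
  have hmainj : π ^ 2 / 6 * ℓ ^ (j + 1) * ((derivative P).eval 1 / Δ' + (j : ℝ) * P.eval 1) =
      Δ'⁻¹ ^ 2 * (((j.choose j : ℕ) : ℝ) * γ (j - j) * (π ^ 2 / 6 * Real.log M ^ (j + 1) * c j)) := by
    rw [Nat.choose_self, Nat.sub_self, hγ, hc]
    simp only [integral_exp_neg_logPow_zero, Nat.cast_one, one_mul]
    rw [h1θ, hΛ, mul_pow]
    have hΔ0 : Δ' ≠ 0 := hΔ.ne'
    rcases Nat.eq_zero_or_pos j with rfl | hj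
    · field_simp
      simp
    · obtain ⟨n, rfl⟩ : ∃ n, j = n + 1 := ⟨j - 1, by omega⟩
      simp only [Nat.add_sub_cancel, inv_pow]
      field_simp
      ring
  -- each term: `ℓ² (C γ D_i) − [i = j] main = C γ Δ'⁻² (Λ² D_i − ζ2 Λ^{i+1} c_i) + C γ Δ'⁻² ζ2 Λ^{i+1} c_i · [i ≠ j]`… we bound uniformly:
  have hterm : ∀ i ∈ range (j + 1),
      |ℓ ^ 2 * (((j.choose i : ℕ) : ℝ) * γ (j - i) *
          ∑ m ∈ Finset.Icc 1 ⌊M⌋₊, (ArithmeticFunction.moebius m : ℝ) * ((psi m)⁻¹ * (m : ℝ)⁻¹) *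
            P.eval (Real.log (M / m) / Real.log M) * (Real.log (M / m) - θ * Real.log M) ^ i) -
        Δ'⁻¹ ^ 2 * (((j.choose i : ℕ) : ℝ) * γ (j - i) * (π ^ 2 / 6 * Real.log M ^ (i + 1) * c i))| ≤
        ((j.choose i : ℕ) : ℝ) * |γ (j - i)| * (K i * Δ' ^ i / Δ' ^ 2) * ℓ ^ i := by
    intro i _
    have hD := hK i M hM3
    have hℓΛ : ℓ ^ 2 = Δ'⁻¹ ^ 2 * Real.log M ^ 2 := by
      rw [hΛ, mul_pow, ← mul_assoc, ← mul_pow, inv_mul_cancel₀ hΔ.ne', one_pow, one_mul]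
    rw [hℓΛ, show Δ'⁻¹ ^ 2 * Real.log M ^ 2 * (((j.choose i : ℕ) : ℝ) * γ (j - i) *
          ∑ m ∈ Finset.Icc 1 ⌊M⌋₊, (ArithmeticFunction.moebius m : ℝ) * ((psi m)⁻¹ * (m : ℝ)⁻¹) *
            P.eval (Real.log (M / m) / Real.log M) * (Real.log (M / m) - θ * Real.log M) ^ i) -
        Δ'⁻¹ ^ 2 * (((j.choose i : ℕ) : ℝ) * γ (j - i) * (π ^ 2 / 6 * Real.log M ^ (i + 1) * c i)) =
        (Δ'⁻¹ ^ 2 * (((j.choose i : ℕ) : ℝ) * γ (j - i))) *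
          (Real.log M ^ 2 * ∑ m ∈ Finset.Icc 1 ⌊M⌋₊, (ArithmeticFunction.moebius m : ℝ) * ((psi m)⁻¹ * (m : ℝ)⁻¹) *
              P.eval (Real.log (M / m) / Real.log M) * (Real.log (M / m) - θ * Real.log M) ^ i -
            π ^ 2 / 6 * Real.log M ^ (i + 1) * c i) by ring, abs_mul]
    have hA : |Δ'⁻¹ ^ 2 * (((j.choose i : ℕ) : ℝ) * γ (j - i))| = Δ'⁻¹ ^ 2 * (((j.choose i : ℕ) : ℝ) * |γ (j - i)|) := by
      rw [abs_mul, abs_mul, abs_of_nonneg (by positivity : (0:ℝ) ≤ Δ'⁻¹ ^ 2), Nat.abs_cast]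
    rw [hA]
    calc Δ'⁻¹ ^ 2 * (((j.choose i : ℕ) : ℝ) * |γ (j - i)|) * _ ≤ Δ'⁻¹ ^ 2 * (((j.choose i : ℕ) : ℝ) * |γ (j - i)|) * (K i * Real.log M ^ i) :=
          mul_le_mul_of_nonneg_left hD (by positivity)
      _ = ((j.choose i : ℕ) : ℝ) * |γ (j - i)| * (K i * Δ' ^ i / Δ' ^ 2) * ℓ ^ i := by
          rw [hΛ, mul_pow, div_eq_mul_inv, inv_pow]; ring
  -- the lower-order main parts: `|Δ'⁻² C γ ζ2 Λ^{i+1} c_i| ≤ C|γ| ζ2 Δ'^{i+1}/Δ'² |c_i| ℓ^{i+1} ≤ … ℓ^j` for `i < j`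
  have hlow : ∀ i ∈ range j,
      |Δ'⁻¹ ^ 2 * (((j.choose i : ℕ) : ℝ) * γ (j - i) * (π ^ 2 / 6 * Real.log M ^ (i + 1) * c i))| ≤
        ((j.choose i : ℕ) : ℝ) * |γ (j - i)| * (π ^ 2 / 6 * Δ' ^ (i + 1) / Δ' ^ 2 * |c i|) * ℓ ^ j := by
    intro i hi
    have hij : i + 1 ≤ j := Finset.mem_range.mp hi
    rw [hΛ, mul_pow]
    rw [show Δ'⁻¹ ^ 2 * (((j.choose i : ℕ) : ℝ) * γ (j - i) * (π ^ 2 / 6 * (Δ' ^ (i + 1) * ℓ ^ (i + 1)) * c i)) =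
        ((((j.choose i : ℕ) : ℝ) * (π ^ 2 / 6 * Δ' ^ (i + 1) / Δ' ^ 2)) * ℓ ^ (i + 1)) * (γ (j - i) * c i) by
          rw [div_eq_mul_inv _ (Δ' ^ 2), inv_pow]; ring,
      abs_mul, abs_of_nonneg (by positivity : (0 : ℝ) ≤ (((j.choose i : ℕ) : ℝ) * (π ^ 2 / 6 * Δ' ^ (i + 1) / Δ' ^ 2)) * ℓ ^ (i + 1)),
      abs_mul]
    have hpow : ℓ ^ (i + 1) ≤ ℓ ^ j := pow_le_pow_right₀ hℓ1 hij
    calc ((j.choose i : ℕ) : ℝ) * (π ^ 2 / 6 * Δ' ^ (i + 1) / Δ' ^ 2) * ℓ ^ (i + 1) * (|γ (j - i)| * |c i|)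
        ≤ ((j.choose i : ℕ) : ℝ) * (π ^ 2 / 6 * Δ' ^ (i + 1) / Δ' ^ 2) * ℓ ^ j * (|γ (j - i)| * |c i|) := by gcongr
      _ = _ := by ring
  -- assemble: split off the `i = j` main part
  rw [hmainj, Finset.sum_range_succ, show ∀ (a b x : ℝ), a + b - x = (a - 0) + (b - x) from fun a b x ↦ by ring]
  have hsplit_low : ∑ i ∈ range j, ℓ ^ 2 * (((j.choose i : ℕ) : ℝ) * γ (j - i) *
        ∑ m ∈ Finset.Icc 1 ⌊M⌋₊, (ArithmeticFunction.moebius m : ℝ) * ((psi m)⁻¹ * (m : ℝ)⁻¹) *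
          P.eval (Real.log (M / m) / Real.log M) * (Real.log (M / m) - θ * Real.log M) ^ i) - 0 =
      ∑ i ∈ range j, ((ℓ ^ 2 * (((j.choose i : ℕ) : ℝ) * γ (j - i) *
          ∑ m ∈ Finset.Icc 1 ⌊M⌋₊, (ArithmeticFunction.moebius m : ℝ) * ((psi m)⁻¹ * (m : ℝ)⁻¹) *
            P.eval (Real.log (M / m) / Real.log M) * (Real.log (M / m) - θ * Real.log M) ^ i) -
          Δ'⁻¹ ^ 2 * (((j.choose i : ℕ) : ℝ) * γ (j - i) * (π ^ 2 / 6 * Real.log M ^ (i + 1) * c i))) +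
        Δ'⁻¹ ^ 2 * (((j.choose i : ℕ) : ℝ) * γ (j - i) * (π ^ 2 / 6 * Real.log M ^ (i + 1) * c i))) := by
    rw [sub_zero]; exact Finset.sum_congr rfl fun i _ ↦ by ring
  rw [hsplit_low]
  have hEsum : ∑ i ∈ range (j + 1), E i * ℓ ^ j = (∑ i ∈ range (j + 1), E i) * ℓ ^ j := by rw [Finset.sum_mul]
  rw [← hEsum, Finset.sum_range_succ]
  refine (abs_add_le _ _).trans (add_le_add ?_ ?_)
  · refine (Finset.abs_sum_le_sum_abs _ _).trans (Finset.sum_le_sum fun i hi ↦ ?_)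
    have hi' : i ∈ range (j + 1) := Finset.mem_range.mpr (by have := Finset.mem_range.mp hi; omega)
    have hij : i ≤ j := by have := Finset.mem_range.mp hi; omega
    refine (abs_add_le _ _).trans ?_
    have h1 := hterm i hi'
    have h2 := hlow i hi
    have hpow : ℓ ^ i ≤ ℓ ^ j := pow_le_pow_right₀ hℓ1 hij
    calc _ ≤ ((j.choose i : ℕ) : ℝ) * |γ (j - i)| * (K i * Δ' ^ i / Δ' ^ 2) * ℓ ^ i +
          ((j.choose i : ℕ) : ℝ) * |γ (j - i)| * (π ^ 2 / 6 * Δ' ^ (i + 1) / Δ' ^ 2 * |c i|) * ℓ ^ j := add_le_add h1 h2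
      _ ≤ ((j.choose i : ℕ) : ℝ) * |γ (j - i)| * (K i * Δ' ^ i / Δ' ^ 2) * ℓ ^ j +
          ((j.choose i : ℕ) : ℝ) * |γ (j - i)| * (π ^ 2 / 6 * Δ' ^ (i + 1) / Δ' ^ 2 * |c i|) * ℓ ^ j := by
          have : 0 ≤ ((j.choose i : ℕ) : ℝ) * |γ (j - i)| * (K i * Δ' ^ i / Δ' ^ 2) := by
            have := hK0 i; positivity
          nlinarith
      _ = E i * ℓ ^ j := by rw [hE]; ring
  · have h1 := hterm j (Finset.self_mem_range_succ j)
    refine h1.trans ?_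
    have : 0 ≤ ((j.choose j : ℕ) : ℝ) * |γ (j - j)| * (π ^ 2 / 6 * Δ' ^ (j + 1) / Δ' ^ 2 * |c j|) * ℓ ^ j := by positivity
    calc ((j.choose j : ℕ) : ℝ) * |γ (j - j)| * (K j * Δ' ^ j / Δ' ^ 2) * ℓ ^ j
        ≤ ((j.choose j : ℕ) : ℝ) * |γ (j - j)| * (K j * Δ' ^ j / Δ' ^ 2) * ℓ ^ j +
          ((j.choose j : ℕ) : ℝ) * |γ (j - j)| * (π ^ 2 / 6 * Δ' ^ (j + 1) / Δ' ^ 2 * |c j|) * ℓ ^ j := by linarith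
      _ = E j * ℓ ^ j := by rw [hE]; ring

end Summit.Parity.GeneralizedHardyLittlewood.Theorems.MomentsBeyondDiagonal.FirstOrderAFE

end
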